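import Literature.NumberTheory.GaloisCohomology.CyclotomicTowerMuKilling
import Mathlib.NumberTheory.NumberField.Completion.LiesOverInstances
import HarnessLib

/-!
# Classes of `H²(Γ_K, μ_N)` vanishing at the real places die in a `ℤ_p`-tower
# (Serre II §4.4 Prop. 13 / Tate VII §10 — number fields WITH real places)

The tree's `exists_resH_comap_span_pow_kummer_eq_zero` (`CyclotomicTowerMuKilling.lean`) kills a class
`c ∈ H²(Γ_K, μ_N)` (`N ∣ p^k`, localisations vanishing off a finite set `S` of finite places) on a
layer `V_m = φ⁻¹(p^m ℤ_p)` of a `ℤ_p`-tower with non-trivial local towers, for `K` TOTALLY COMPLEX: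
the only use of that hypothesis is the local triviality of the base change of the representing
cocycle at the (complex) infinite places of the layer field `K_m`, needed by the Hasse principle
(`twoCocycle_cob_of_locallyTrivial`).  Over a number field with real places the layers `K_m` of the
cyclotomic `ℤ_p`-tower stay real above the real places of `K` (their decomposition groups are
trivial), so a class that is non-zero at a real place never dies in the tower.  This file proves the
sharp statement: the SAME conclusion for every number field `K`, under the extra hypothesis that `c`
VANISHES AT EVERY REAL PLACE of `K` (`galoisCohomology.localization (mu K N) (Sum.inl w) 2 c = 0`).

* `resMu_eq_of_localization_inl` — the localisation at an INFINITE place `w`, pushed along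
  `μ_N(K̄)| → μ_N(K̄_w)` (`muTransfer`), is the restriction `Res_{K_w/K}` of the anabelian files
  (`Prop121vii.resMu`; the infinite analogue of `cohomologyMap_muLocalIso_localization`);
* `exists_cob_infinitePlace_of_localization_eq_zero` — if `loc_w c = 0` then the Kummer image of a
  representing cocycle splits over `Γ_{K_w}` (as `K̄_wˣ`-valued cochains);
* `exists_cob_infinitePlace_baseChange` — **transfer to the places above**: for a finite extension
  `K'/K` and an infinite place `w'` of `K'` above `w`, a splitting over `Γ_{K_w}` of a `K̄ˣ`-valued
  `2`-cocycle of `Γ_K` yields a splitting over `Γ_{K'_{w'}}` of its base change to `Γ_{K'}` (pull back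
  along Mathlib's `completionMap : K_w → K'_{w'}` and change the compatible pair,
  `exists_cob_pullback_iff_of_compatible`; the infinite-place twin of
  `exists_cob_adicCompletion_baseChange_of_subgroup`);
* **`exists_resH_comap_span_pow_kummer_eq_zero_of_forall_isReal`** — the killing theorem for every
  number field `K`, for classes vanishing at the real places.

This is node (N1)+(N2) of the `∀ K` form of `poitouTate_sum_localTatePairing_eq_zero` (cell
`bsd-cn100`, seat transfer-2 g5).  Proof file: theorems only (no definition, no named fact, no
instance; D-0026).  HONEST FRAMING: textbook Galois cohomology; proves no case of BSD.

## References

* J.-P. Serre, *Cohomologie galoisienne* / *Galois Cohomology* (1997), I §2.4 (compatible pairs),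
  II §4.4 Prop. 13 and Lemme 1, II §3.3 Prop. 9. [SerreGaloisCohomology1997]
* J. W. S. Cassels, A. Fröhlich (eds.), *Algebraic Number Theory* (1967), Ch. VII (Tate) §9.6–§10.
  [CasselsFrohlichANT1967]

## Tree search

`lean search 'exists_resH_comap_span_pow_kummer|exists_cob_adicCompletion_baseChange|muLocalIso_localization'`:
the totally complex killing theorem, the finite-place transfer and the finite-place dictionary — no
infinite-place versions.  Inputs: `exists_cob_pullback_iff_of_compatible`, `twoCocycle_baseChange`,
`twoCocycle_cob_of_locallyTrivial`, `cohomologyMap_kummerι_resMu`, `exists_unitsHom`, `muTransfer_mu`,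
Mathlib `NumberField.LiesOver.completionMap`.
-/

noncomputable section

open CategoryTheory Function Field IntermediateField NumberField IsDedekindDomain
open scoped NumberField

universe u

namespace Literature.NumberTheory.GaloisCohomology

open _root_.TopRep _root_.ContRepresentation _root_.ContinuousCohomology
open Literature.NumberTheory.GaloisRepresentations
open Literature.NumberTheory.GaloisRepresentations.DiscreteGaloisModule
open Literature.NumberTheory.GaloisRepresentations.LocalWeilDatum
open Literature.AnabelianGeometry.AbsoluteAnabelian
open Literature.AnabelianGeometry.AbsoluteAnabelian.Prop121vii

/-! ### §1. The localisation at an infinite place, in the anabelian dialect -/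

section Infinite

variable {K : Type} [Field K] [NumberField K] {n : ℕ} (w : InfinitePlace K)

/-- `ContinuousCohomology.map` along equal group homomorphisms and pointwise equal coefficient
morphisms agree (restated from `LocalInvariantMapEvaluation.lean`, where it is private). [folklore] -/
private theorem contMap_congr' {k : Type*} [Ring k] [TopologicalSpace k] {G H : Type u} [Group G]
    [TopologicalSpace G] [IsTopologicalGroup G] [Group H] [TopologicalSpace H] [IsTopologicalGroup H]
    {X : TopRep k G} {Y : TopRep k H} {φ ψ : H →ₜ* G} (h : φ = ψ)
    (f : TopRep.res (φ : H →* G) X ⟶ Y) (g : TopRep.res (ψ : H →* G) X ⟶ Y)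
    (hfg : ∀ x, f.hom x = g.hom x) (m : ℕ) :
    ContinuousCohomology.map φ f m = ContinuousCohomology.map ψ g m := by
  subst h
  have : f = g := TopRep.hom_ext (ContIntertwiningMap.ext (ContinuousLinearMap.ext hfg))
  rw [this]

/-- **The localisation at an infinite place, pushed along `μ_N(K̄)| → μ_N(K̄_w)`, is `Res_{K_w/K}`.**
For `c ∈ H^k(Γ_K, μ_N)` and the morphism `t : μ_N(K̄)|_{Γ_{K_w}} → μ_N(K̄_w)` of `Γ_{K_w}`-modules given
by the chosen embedding `K̄ → K̄_w` (`muTransfer`, equivariant by `muTransfer_mu`):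
`H^k(t) (loc_w c) = resMu K K_w N k c` — both are "pull back along `Γ_{K_w} → Γ_K`, push along
`K̄ → K̄_w`" (Mathlib `ContinuousCohomology.map_comp`).  Infinite-place twin of
`cohomologyMap_muLocalIso_localization`. [cite: SerreGaloisCohomology1997, I §2.4] -/
theorem resMu_eq_of_localization_inl (k : ℕ) (c : galoisCohomology (mu K n) k)
    (t : ((mu K n).restrict (absGaloisRestrict K w.Completion)).toTopRep ⟶ (mu w.Completion n).toTopRep)
    (ht : ∀ x, t.hom x = muTransfer K w.Completion n x) :
    haveI : CompactSpace (absoluteGaloisGroup K) := absoluteGaloisGroup_compactSpace K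
    haveI : CompactSpace (absoluteGaloisGroup w.Completion) := absoluteGaloisGroup_compactSpace _
    (cohomologyMap t k).hom (galoisCohomology.localization (mu K n) (Sum.inl w) k c) =
      resMu K w.Completion n k c := by
  haveI : CompactSpace (absoluteGaloisGroup K) := absoluteGaloisGroup_compactSpace K
  haveI : CompactSpace (absoluteGaloisGroup w.Completion) := absoluteGaloisGroup_compactSpace _
  have key : ContinuousCohomology.map (absGaloisRestrict K w.Completion)
        (TopRep.ofHom ⟨ContinuousLinearMap.id ℤ (MuCarrier K n), fun _ => rfl⟩) k ≫
      ContinuousCohomology.map (ContinuousMonoidHom.id _) (resIdHom t) k =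
    ContinuousCohomology.map (absGaloisRestrict K w.Completion)
      (resCoeff K w.Completion n) k := by
    rw [← ContinuousCohomology.map_comp]
    refine contMap_congr' (ContinuousMonoidHom.ext fun _ => rfl) _ _ (fun x => ?_) k
    change t.hom x = (resCoeff K w.Completion n).hom x
    rw [ht x, resCoeff_hom_apply]
    exact muVal_injective w.Completion n rfl
  exact congrArg (fun T => (ConcreteCategory.hom T) c) key

/-- **If `loc_w c = 0` at an infinite place `w`, then `Res_{K_w/K} c = 0`** (apply `H^k(t)` to
`loc_w c = 0`, `resMu_eq_of_localization_inl`). [cite: SerreGaloisCohomology1997, I §2.4] -/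
theorem resMu_eq_zero_of_localization_inl_eq_zero (k : ℕ) (c : galoisCohomology (mu K n) k)
    (h : haveI : CompactSpace (absoluteGaloisGroup K) := absoluteGaloisGroup_compactSpace K
      haveI : CompactSpace (absoluteGaloisGroup w.Completion) := absoluteGaloisGroup_compactSpace _
      galoisCohomology.localization (mu K n) (Sum.inl w) k c = 0) :
    haveI : CompactSpace (absoluteGaloisGroup K) := absoluteGaloisGroup_compactSpace K
    haveI : CompactSpace (absoluteGaloisGroup w.Completion) := absoluteGaloisGroup_compactSpace _
    resMu K w.Completion n k c = 0 := by
  haveI : CompactSpace (absoluteGaloisGroup K) := absoluteGaloisGroup_compactSpace K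
  haveI : CompactSpace (absoluteGaloisGroup w.Completion) := absoluteGaloisGroup_compactSpace _
  -- the transfer morphism `t : μ_N(K̄)| → μ_N(K̄_w)`
  let t : ((mu K n).restrict (absGaloisRestrict K w.Completion)).toTopRep ⟶ (mu w.Completion n).toTopRep :=
    TopRep.ofHom ⟨⟨(muTransfer K w.Completion n).toIntLinearMap, continuous_of_discreteTopology⟩,
      fun σ => by
        refine ContinuousLinearMap.ext fun x => ?_
        exact muTransfer_mu K w.Completion n σ x⟩
  rw [← resMu_eq_of_localization_inl w k c t (fun _ => rfl)]
  change (cohomologyMap t k).hom (galoisCohomology.localization (mu K n) (Sum.inl w) k c) = 0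
  rw [h]
  exact map_zero _

/-- **A class vanishing at the infinite place `w` has a Kummer cocycle that splits over `Γ_{K_w}`.**
Let `c ∈ H²(Γ_K, μ_N)` be represented by the cocycle `f`, `e = muVal ∘ f` its `K̄ˣ`-valued form.  If
`loc_w c = 0`, then `ι ∘ e ∘ (res × res)` is the coboundary of a locally constant cochain of `Γ_{K_w}`
with values in `K̄_wˣ` (`Res_{K_w/K} c = 0`, the Kummer map `H²(μ_N) → H²(K̄_wˣ)` and
`twoCocycleClass_eq_zero_iff_exists_mul`).  This is the entry at `w` of the hypothesis `hinf` of the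
Hasse principle `twoCocycle_cob_of_locallyTrivial`. [cite: SerreGaloisCohomology1997, I §2.4, II §1.1] -/
theorem exists_cob_infinitePlace_of_localization_eq_zero
    (c : galoisCohomology (mu K n) 2)
    (f : haveI : CompactSpace (absoluteGaloisGroup K) := absoluteGaloisGroup_compactSpace K
      contTwoCocycles (mu K n).toTopRep)
    (hf : haveI : CompactSpace (absoluteGaloisGroup K) := absoluteGaloisGroup_compactSpace K
      twoCocycleClass (mu K n).toTopRep f = c)
    (h : haveI : CompactSpace (absoluteGaloisGroup K) := absoluteGaloisGroup_compactSpace K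
      haveI : CompactSpace (absoluteGaloisGroup w.Completion) := absoluteGaloisGroup_compactSpace _
      galoisCohomology.localization (mu K n) (Sum.inl w) 2 c = 0) :
    ∃ b : absoluteGaloisGroup w.Completion → (AlgebraicClosure w.Completion)ˣ,
      IsLocallyConstant b ∧ ∀ x y,
        Units.map (absClosureEmbedding K w.Completion : AlgebraicClosure K →* AlgebraicClosure w.Completion)
          (muVal K n (f.1 (absGaloisRestrict K w.Completion x, absGaloisRestrict K w.Completion y))) =
        b x * x • b y / b (x * y) := by
  haveI : CompactSpace (absoluteGaloisGroup K) := absoluteGaloisGroup_compactSpace K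
  haveI : CompactSpace (absoluteGaloisGroup w.Completion) := absoluteGaloisGroup_compactSpace _
  haveI : CharZero w.Completion := charZero_of_injective_algebraMap (algebraMap K w.Completion).injective
  set res := absGaloisRestrict K w.Completion with hres
  -- the Kummer image `F` of `f`
  set F : contTwoCocycles (units K).toTopRep :=
    contTwoCocycles.pullback (ContinuousMonoidHom.id _) (resIdHom (kummerι K n)) f with hF_def
  have hF : ∀ σ τ, F.1 (σ, τ) = UnitsCarrier.ofUnits (muVal K n (f.1 (σ, τ))) := fun _ _ => rfl
  have hKc : (cohomologyMap (kummerι K n) 2).hom c = twoCocycleClass _ F := by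
    rw [← hf]; exact cohomologyMap_twoCocycleClass (kummerι K n) f
  obtain ⟨φu, hφu⟩ := exists_unitsHom (F := K) w.Completion
  have h0 : resMu K w.Completion n 2 c = 0 := resMu_eq_zero_of_localization_inl_eq_zero w 2 c h
  have h1 : (ContinuousCohomology.map res φu 2).hom (twoCocycleClass _ F) = 0 := by
    rw [← hKc, ← cohomologyMap_kummerι_resMu K w.Completion n φu hφu 2 c, h0]; exact map_zero _
  have h2 : twoCocycleClass _ (contTwoCocycles.pullback res φu F) = 0 := by
    rw [← map_twoCocycleClass]; exact h1
  have hFv : ∀ x y : absoluteGaloisGroup w.Completion,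
      (contTwoCocycles.pullback res φu F).1 (x, y) = UnitsCarrier.ofUnits
        (Units.map (absClosureEmbedding K w.Completion : AlgebraicClosure K →* AlgebraicClosure w.Completion)
          (muVal K n (f.1 (res x, res y)))) := by
    intro x y
    rw [contTwoCocycles.pullback_apply, hF, hφu]
  obtain ⟨b, hb_lc, hb⟩ := (twoCocycleClass_eq_zero_iff_exists_mul (F := w.Completion) _ _ hFv).mp h2
  exact ⟨b, hb_lc, fun x y => hb x y⟩

end Infinite

/-! ### §2. Transfer of archimedean local splittings to the places of a finite extension -/

section Transfer

variable {K : Type u} [Field K] [NumberField K] {K' : Type u} [Field K'] [NumberField K'] [Algebra K K']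

omit [NumberField K] [NumberField K'] in
/-- **An archimedean local splitting passes to the infinite places above.**  Let `K'/K` be finite,
`e : Γ_K × Γ_K → K̄ˣ` a locally constant `2`-cocycle and `w'` an infinite place of `K'` above the place
`w` of `K`.  If `e` (pulled back along `Γ_{K_w} → Γ_K`, pushed into `K̄_wˣ`) is a coboundary over
`Γ_{K_w}`, then the base change `e'(x, y) = ι(e(res x, res y))` to `Γ_{K'}` is a coboundary over
`Γ_{K'_{w'}}`: pull the cochain back along `Γ_{K'_{w'}} → Γ_{K_w}` (through Mathlib's `completionMap :
K_w → K'_{w'}`) and pass from the compatible pair through `K_w` to the pair through `K'`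
(`exists_cob_pullback_iff_of_compatible`).  Infinite-place twin of
`exists_cob_adicCompletion_baseChange_of_subgroup`. [cite: SerreGaloisCohomology1997, I §2.4, II §1.1] -/
theorem exists_cob_infinitePlace_baseChange
    (e : absoluteGaloisGroup K → absoluteGaloisGroup K → (AlgebraicClosure K)ˣ)
    (hlc : IsLocallyConstant fun p : absoluteGaloisGroup K × absoluteGaloisGroup K => e p.1 p.2)
    (hcoc : ∀ σ τ υ, e σ τ * e (σ * τ) υ = σ • e τ υ * e σ (τ * υ))
    (w' : InfinitePlace K')
    (hloc : ∃ b : absoluteGaloisGroup ((w'.comap (algebraMap K K')).Completion) →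
        (AlgebraicClosure ((w'.comap (algebraMap K K')).Completion))ˣ,
      IsLocallyConstant b ∧ ∀ x y,
        Units.map (absClosureEmbedding K ((w'.comap (algebraMap K K')).Completion) :
            AlgebraicClosure K →* AlgebraicClosure ((w'.comap (algebraMap K K')).Completion))
          (e (absGaloisRestrict K ((w'.comap (algebraMap K K')).Completion) x)
            (absGaloisRestrict K ((w'.comap (algebraMap K K')).Completion) y)) =
        b x * x • b y / b (x * y)) :
    ∃ b : absoluteGaloisGroup w'.Completion → (AlgebraicClosure w'.Completion)ˣ,
      IsLocallyConstant b ∧ ∀ x y,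
        Units.map (absClosureEmbedding K' w'.Completion : AlgebraicClosure K' →* AlgebraicClosure w'.Completion)
          (Units.map (absClosureEmbedding K K' : AlgebraicClosure K →* AlgebraicClosure K')
            (e (absGaloisRestrict K K' (absGaloisRestrict K' w'.Completion x))
              (absGaloisRestrict K K' (absGaloisRestrict K' w'.Completion y)))) =
        b x * x • b y / b (x * y) := by
  classical
  set w : InfinitePlace K := w'.comap (algebraMap K K') with hw
  haveI hLO : w'.1.LiesOver w.1 := ⟨rfl⟩
  -- the local base change `K_w → K'_{w'}` (Mathlib `completionMap`) and the towers through it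
  letI alg : Algebra w.Completion w'.Completion := (NumberField.LiesOver.completionMap (v := w) (w := w')).toAlgebra
  haveI tower : IsScalarTower K w.Completion w'.Completion := by
    refine IsScalarTower.of_algebraMap_eq fun x => ?_
    have h : algebraMap K w.Completion x = ((WithAbs.toAbs w.1 x : WithAbs w.1) : w.Completion) := rfl
    rw [RingHom.algebraMap_toAlgebra, h, NumberField.LiesOver.completionMap_coe]
    apply InfinitePlace.Completion.ext
    rw [InfinitePlace.Completion.algebraMap_toCompletion, UniformSpace.Completion.algebraMap_def]
    simp [WithAbs.algebraMap_left_apply, WithAbs.algebraMap_right_apply]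
  haveI towerΩ : IsScalarTower K w.Completion (AlgebraicClosure w'.Completion) :=
    IsScalarTower.of_algebraMap_eq fun x => by
      rw [IsScalarTower.algebraMap_apply K w'.Completion (AlgebraicClosure w'.Completion) x,
        IsScalarTower.algebraMap_apply w.Completion w'.Completion (AlgebraicClosure w'.Completion),
        ← IsScalarTower.algebraMap_apply K w.Completion w'.Completion x]
  -- the tower `K → K' → K'_{w'}` (Mathlib records only `K' → K'_{w'}`)
  haveI tower' : IsScalarTower K K' w'.Completion := by
    refine IsScalarTower.of_algebraMap_eq fun x => ?_
    apply InfinitePlace.Completion.ext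
    rw [InfinitePlace.Completion.algebraMap_toCompletion, UniformSpace.Completion.algebraMap_def,
      InfinitePlace.Completion.algebraMap_apply]
    simp [WithAbs.algebraMap_right_apply]
  haveI towerΩ' : IsScalarTower K K' (AlgebraicClosure w'.Completion) :=
    IsScalarTower.of_algebraMap_eq fun x => by
      rw [IsScalarTower.algebraMap_apply K w'.Completion (AlgebraicClosure w'.Completion) x,
        IsScalarTower.algebraMap_apply K' w'.Completion (AlgebraicClosure w'.Completion),
        ← IsScalarTower.algebraMap_apply K K' w'.Completion x]
  -- pair 1: through `K'`
  let ι₁ : AlgebraicClosure K →ₐ[K] AlgebraicClosure w'.Completion :=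
    ((absClosureEmbedding K' w'.Completion).restrictScalars K).comp (absClosureEmbedding K K')
  have hι₁ : ∀ u, Units.map (ι₁ : AlgebraicClosure K →* AlgebraicClosure w'.Completion) u =
      Units.map (absClosureEmbedding K' w'.Completion : AlgebraicClosure K' →* AlgebraicClosure w'.Completion)
        (Units.map (absClosureEmbedding K K' : AlgebraicClosure K →* AlgebraicClosure K') u) :=
    fun u => Units.ext rfl
  have hr₁ : ∀ (x : absoluteGaloisGroup w'.Completion) (m : AlgebraicClosure K),
      ι₁ (absGaloisRestrict K K' (absGaloisRestrict K' w'.Completion x) • m) = x • ι₁ m := by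
    intro x m
    change absClosureEmbedding K' w'.Completion (absClosureEmbedding K K' _) =
      x • absClosureEmbedding K' w'.Completion (absClosureEmbedding K K' m)
    rw [absGaloisRestrict_apply_smul, absGaloisRestrict_apply_smul]
  -- pair 2: through `K_w`
  let ι₂ : AlgebraicClosure K →ₐ[K] AlgebraicClosure w'.Completion :=
    ((absClosureEmbedding w.Completion w'.Completion).restrictScalars K).comp
      (absClosureEmbedding K w.Completion)
  have hι₂ : ∀ u, Units.map (ι₂ : AlgebraicClosure K →* AlgebraicClosure w'.Completion) u =
      Units.map (absClosureEmbedding w.Completion w'.Completion :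
          AlgebraicClosure w.Completion →* AlgebraicClosure w'.Completion)
        (Units.map (absClosureEmbedding K w.Completion :
          AlgebraicClosure K →* AlgebraicClosure w.Completion) u) :=
    fun u => Units.ext rfl
  have hr₂ : ∀ (x : absoluteGaloisGroup w'.Completion) (m : AlgebraicClosure K),
      ι₂ (absGaloisRestrict K w.Completion (absGaloisRestrict w.Completion w'.Completion x) • m) = x • ι₂ m := by
    intro x m
    change absClosureEmbedding w.Completion w'.Completion (absClosureEmbedding K w.Completion _) =
      x • absClosureEmbedding w.Completion w'.Completion (absClosureEmbedding K w.Completion m)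
    rw [absGaloisRestrict_apply_smul, absGaloisRestrict_apply_smul]
  -- pair 2 gives a coboundary: pull back the coboundary over `Γ_{K_w}`
  have h2 : ∃ b : absoluteGaloisGroup w'.Completion → (AlgebraicClosure w'.Completion)ˣ,
      IsLocallyConstant b ∧ ∀ x y,
        Units.map (ι₂ : AlgebraicClosure K →* AlgebraicClosure w'.Completion)
          (e (absGaloisRestrict K w.Completion (absGaloisRestrict w.Completion w'.Completion x))
            (absGaloisRestrict K w.Completion (absGaloisRestrict w.Completion w'.Completion y))) =
        b x * x • b y / b (x * y) := by
    obtain ⟨b₀, hb₀, hb₀e⟩ := hloc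
    let ιw : (AlgebraicClosure w.Completion)ˣ →* (AlgebraicClosure w'.Completion)ˣ :=
      Units.map (absClosureEmbedding w.Completion w'.Completion :
        AlgebraicClosure w.Completion →* AlgebraicClosure w'.Completion)
    have hιw : ∀ (x : absoluteGaloisGroup w'.Completion) (a : (AlgebraicClosure w.Completion)ˣ),
        ιw (absGaloisRestrict w.Completion w'.Completion x • a) = x • ιw a := by
      intro x a
      ext
      change absClosureEmbedding w.Completion w'.Completion
          ((absGaloisRestrict w.Completion w'.Completion x • a :
            (AlgebraicClosure w.Completion)ˣ) : AlgebraicClosure w.Completion) =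
        x • absClosureEmbedding w.Completion w'.Completion (a : AlgebraicClosure w.Completion)
      rw [Units.coe_smul, absGaloisRestrict_apply_smul]
    refine ⟨fun x => ιw (b₀ (absGaloisRestrict w.Completion w'.Completion x)),
      (hb₀.comp_continuous (absGaloisRestrict w.Completion w'.Completion).continuous).comp _,
      fun x y => ?_⟩
    rw [hι₂]
    have key := hb₀e (absGaloisRestrict w.Completion w'.Completion x)
      (absGaloisRestrict w.Completion w'.Completion y)
    change ιw (Units.map (absClosureEmbedding K w.Completion :
        AlgebraicClosure K →* AlgebraicClosure w.Completion) (e _ _)) = _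
    rw [key, map_div, map_mul, hιw, ← map_mul (absGaloisRestrict w.Completion w'.Completion)]
  -- transfer from pair 2 to the standard pair to pair 1
  have hstd := (exists_cob_pullback_iff_of_compatible K w'.Completion e hlc hcoc ι₂ _ hr₂).mp h2
  have h1 := (exists_cob_pullback_iff_of_compatible K w'.Completion e hlc hcoc ι₁ _ hr₁).mpr hstd
  simp_rw [hι₁] at h1
  exact h1

end Transfer

/-! ### §3. The killing theorem over an arbitrary number field -/

section Main

variable (K : Type) [Field K] [NumberField K] {p : ℕ} [hp : Fact p.Prime]

/-- **Classes of `H²(Γ_K, μ_N)` with finite support that VANISH AT THE REAL PLACES die on a layer of a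
`ℤ_p`-tower with non-trivial local towers** — any number field `K` (Serre II §4.4 Prop. 13 / Lemme 1,
II §3.3 Prop. 9; Tate VII §10), `N ∣ p^k`, `φ : Γ_K → ℤ_p` continuous and non-trivial on every
decomposition group, `c ∈ H²(Γ_K, μ_N)` with `loc_v c = 0` for the finite `v ∉ S` and `loc_w c = 0` for
every REAL place `w`: for some `m`, `res_{V_m}(Kummer c) = 0` in `H²(V_m, K̄ˣ)`, `V_m = φ⁻¹(p^m ℤ_p)`.
Same proof as the totally complex `exists_resH_comap_span_pow_kummer_eq_zero`; at an infinite place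
`w'` of the layer field `K_m` the base-changed cocycle splits because it splits over `K_w`, `w` the
place below (trivially at a complex `w`, by hypothesis at a real one:
`exists_cob_infinitePlace_of_localization_eq_zero`), transported by `exists_cob_infinitePlace_baseChange`.
[cite: SerreGaloisCohomology1997, II §4.4 Prop. 13 (with Lemme 1) and II §3.3 Prop. 9]
[cite: CasselsFrohlichANT1967, Ch. VII §9.6–§10] -/
theorem exists_resH_comap_span_pow_kummer_eq_zero_of_forall_isReal
    (φ : absoluteGaloisGroup K →ₜ* Multiplicative ℤ_[p])
    (hφ : ∀ v : HeightOneSpectrum (𝓞 K), ∃ σ : absoluteGaloisGroup (v.adicCompletion K),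
      φ (absGaloisRestrict K (v.adicCompletion K) σ) ≠ 1)
    {N : ℕ} [NeZero N] {k : ℕ} (hN : N ∣ p ^ k) (c : galoisCohomology (mu K N) 2)
    (S : Finset (HeightOneSpectrum (𝓞 K)))
    (hS : ∀ v ∉ S, galoisCohomology.localization (mu K N) (Sum.inr v) 2 c = 0)
    (hreal : ∀ w : InfinitePlace K, w.IsReal →
      haveI : CompactSpace (absoluteGaloisGroup K) := absoluteGaloisGroup_compactSpace K
      haveI : CompactSpace (absoluteGaloisGroup w.Completion) := absoluteGaloisGroup_compactSpace _
      galoisCohomology.localization (mu K N) (Sum.inl w) 2 c = 0) :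
    haveI : CompactSpace (absoluteGaloisGroup K) := absoluteGaloisGroup_compactSpace K
    ∃ m : ℕ, haveI : ((AddSubgroup.toSubgroup (Ideal.span {(p : ℤ_[p]) ^ m}).toAddSubgroup).comap
        φ.toMonoidHom).Normal := Subgroup.Normal.comap inferInstance _
      resH ((AddSubgroup.toSubgroup (Ideal.span {(p : ℤ_[p]) ^ m}).toAddSubgroup).comap φ.toMonoidHom)
        (units K) 2 ((cohomologyMap (kummerι K N) 2).hom c) = 0 := by
  classical
  have hpp : p.Prime := hp.out
  haveI : CompactSpace (absoluteGaloisGroup K) := absoluteGaloisGroup_compactSpace K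
  -- a `μ_N`-valued cocycle `e` representing `c`, and its Kummer image `F`
  obtain ⟨f, hf⟩ := twoCocycleClass_surjective (mu K N).toTopRep c
  set e : absoluteGaloisGroup K → absoluteGaloisGroup K → (AlgebraicClosure K)ˣ :=
    fun σ τ => muVal K N (f.1 (σ, τ)) with he_def
  have he_val : ∀ σ τ, e σ τ = muVal K N (f.1 (σ, τ)) := fun _ _ => rfl
  have he_lc : IsLocallyConstant fun q : absoluteGaloisGroup K × absoluteGaloisGroup K => e q.1 q.2 :=
    ((IsLocallyConstant.iff_continuous f.1).2 f.1.continuous).comp (muVal K N)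
  have he_coc : ∀ σ τ υ, e σ τ * e (σ * τ) υ = σ • e τ υ * e σ (τ * υ) := fun σ τ υ => by
    have h := congrArg (muVal K N) (f.2 σ τ υ)
    rw [muVal_add, muVal_add] at h
    change σ • e τ υ * e σ (τ * υ) = e (σ * τ) υ * e σ τ at h
    rw [h, mul_comm]
  have he_pow : ∀ σ τ, e σ τ ^ N = 1 := fun σ τ => muVal_pow_eq_one K N _
  set F : contTwoCocycles (units K).toTopRep :=
    contTwoCocycles.pullback (ContinuousMonoidHom.id _) (resIdHom (kummerι K N)) f with hF_def
  have hF : ∀ σ τ, F.1 (σ, τ) = UnitsCarrier.ofUnits (e σ τ) := fun _ _ => rfl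
  have hKc : (cohomologyMap (kummerι K N) 2).hom c = twoCocycleClass _ F := by
    rw [← hf]; exact cohomologyMap_twoCocycleClass (kummerι K N) f
  -- the local splittings at the infinite places of `K` (complex: trivial group; real: hypothesis)
  have hinfK : ∀ w : InfinitePlace K,
      ∃ b : absoluteGaloisGroup w.Completion → (AlgebraicClosure w.Completion)ˣ,
        IsLocallyConstant b ∧ ∀ x y,
          Units.map (absClosureEmbedding K w.Completion : AlgebraicClosure K →* AlgebraicClosure w.Completion)
            (e (absGaloisRestrict K w.Completion x) (absGaloisRestrict K w.Completion y)) =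
          b x * x • b y / b (x * y) := by
    intro w
    rcases w.isReal_or_isComplex with hw | hw
    · exact exists_cob_infinitePlace_of_localization_eq_zero w c f hf (hreal w hw)
    · haveI := subsingleton_absoluteGaloisGroup_completion_of_isComplex w hw
      refine ⟨fun _ => Units.map (absClosureEmbedding K w.Completion : AlgebraicClosure K →* AlgebraicClosure w.Completion)
          (e (absGaloisRestrict K w.Completion 1) (absGaloisRestrict K w.Completion 1)),
        IsLocallyConstant.const _, fun x y => ?_⟩
      rw [Subsingleton.elim x 1, Subsingleton.elim y 1, one_smul, mul_one, mul_div_cancel_right]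
  -- notation for the layers
  set V : ℕ → Subgroup (absoluteGaloisGroup K) := fun m =>
    (AddSubgroup.toSubgroup (Ideal.span {(p : ℤ_[p]) ^ m}).toAddSubgroup).comap φ.toMonoidHom with hV
  have hVn : ∀ m, (V m).Normal := fun m => by rw [hV]; exact Subgroup.Normal.comap inferInstance _
  have hVo : ∀ m, IsOpen ((V m : Subgroup (absoluteGaloisGroup K)) : Set (absoluteGaloisGroup K)) :=
    fun m => isOpen_comap_span_pow φ m
  -- the local statement at a finite place `v` for the layer `m`
  let P : HeightOneSpectrum (𝓞 K) → ℕ → Prop := fun v m =>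
    ∃ b : ((V m).comap ((absGaloisRestrict K (v.adicCompletion K) :
          absoluteGaloisGroup (v.adicCompletion K) →ₜ* absoluteGaloisGroup K) :
          absoluteGaloisGroup (v.adicCompletion K) →* absoluteGaloisGroup K)) →
        (AlgebraicClosure (v.adicCompletion K))ˣ,
      IsLocallyConstant b ∧ ∀ x y : (V m).comap ((absGaloisRestrict K (v.adicCompletion K) :
          absoluteGaloisGroup (v.adicCompletion K) →ₜ* absoluteGaloisGroup K) :
          absoluteGaloisGroup (v.adicCompletion K) →* absoluteGaloisGroup K),
        Units.map (absClosureEmbedding K (v.adicCompletion K) :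
            AlgebraicClosure K →* AlgebraicClosure (v.adicCompletion K))
          (e (absGaloisRestrict K (v.adicCompletion K) (x : absoluteGaloisGroup (v.adicCompletion K)))
            (absGaloisRestrict K (v.adicCompletion K) (y : absoluteGaloisGroup (v.adicCompletion K)))) =
        b x * (x : absoluteGaloisGroup (v.adicCompletion K)) • b y / b (x * y)
  -- bad places: a layer beyond which the local statement holds
  have hP : ∀ v : HeightOneSpectrum (𝓞 K), ∃ m₀ : ℕ, ∀ m, m₀ ≤ m → P v m := by
    intro v
    haveI : CharZero (v.adicCompletion K) := charZero_adicCompletion v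
    obtain ⟨m₀, hm₀⟩ := exists_pow_dvd_index_comap_resGal_of_ne_one K p φ v (hφ v) k
    refine ⟨m₀, fun m hm => ?_⟩
    obtain ⟨hlc', hcoc'⟩ := twoCocycle_baseChange K (v.adicCompletion K) e he_lc he_coc
    have hpow' : ∀ σ τ : absoluteGaloisGroup (v.adicCompletion K),
        Units.map (absClosureEmbedding K (v.adicCompletion K) :
            AlgebraicClosure K →* AlgebraicClosure (v.adicCompletion K))
          (e (absGaloisRestrict K (v.adicCompletion K) σ) (absGaloisRestrict K (v.adicCompletion K) τ)) ^ N = 1 :=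
      fun σ τ => by rw [← map_pow, he_pow, map_one]
    have hopen : IsOpen (((V m).comap ((absGaloisRestrict K (v.adicCompletion K) :
          absoluteGaloisGroup (v.adicCompletion K) →ₜ* absoluteGaloisGroup K) :
          absoluteGaloisGroup (v.adicCompletion K) →* absoluteGaloisGroup K) :
        Subgroup (absoluteGaloisGroup (v.adicCompletion K))) : Set (absoluteGaloisGroup (v.adicCompletion K))) :=
      (hVo m).preimage (absGaloisRestrict K (v.adicCompletion K)).continuous
    exact exists_cob_on_subgroup_of_pow_eq_one_of_dvd_index' (v.adicCompletion K) _ hlc' hcoc' hpow' _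
      hopen (hN.trans (hm₀ m hm))
  -- good places: the class is locally trivial, every layer works
  have hgood : ∀ v ∉ S, ∀ m, P v m := by
    intro v hv m
    haveI : CharZero (v.adicCompletion K) := charZero_adicCompletion v
    haveI : CompactSpace (absoluteGaloisGroup (v.adicCompletion K)) :=
      absoluteGaloisGroup_compactSpace (v.adicCompletion K)
    set res := absGaloisRestrict K (v.adicCompletion K) with hres
    obtain ⟨φu, hφu⟩ := exists_unitsHom (F := K) (v.adicCompletion K)
    have h0 : Prop121vii.resMu K (v.adicCompletion K) N 2 c = 0 := by
      rw [← cohomologyMap_muLocalIso_localization, hS v hv]; exact map_zero _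
    have h1 : (ContinuousCohomology.map res φu 2).hom (twoCocycleClass _ F) = 0 := by
      rw [← hKc, ← cohomologyMap_kummerι_resMu K (v.adicCompletion K) N φu hφu 2 c, h0]; exact map_zero _
    have h2 : twoCocycleClass _ (contTwoCocycles.pullback res φu F) = 0 := by
      rw [← map_twoCocycleClass]; exact h1
    have hFv : ∀ x y : absoluteGaloisGroup (v.adicCompletion K),
        (contTwoCocycles.pullback res φu F).1 (x, y) = UnitsCarrier.ofUnits
          (Units.map (absClosureEmbedding K (v.adicCompletion K) :
            AlgebraicClosure K →* AlgebraicClosure (v.adicCompletion K)) (e (res x) (res y))) := by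
      intro x y
      rw [contTwoCocycles.pullback_apply, hF, hφu]
    obtain ⟨b, hb_lc, hb⟩ := (twoCocycleClass_eq_zero_iff_exists_mul (F := v.adicCompletion K) _ _ hFv).mp h2
    exact ⟨fun x => b x, hb_lc.comp_continuous continuous_subtype_val, fun x y => hb x y⟩
  -- a layer that works at every finite place
  obtain ⟨m, hmP⟩ : ∃ m : ℕ, ∀ v, P v m := by
    choose m₀ hm₀ using hP
    refine ⟨S.sup m₀, fun v => ?_⟩
    by_cases hvS : v ∈ S
    · exact hm₀ v _ (Finset.le_sup hvS)
    · exact hgood v hvS _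
  refine ⟨m, ?_⟩
  haveI : (V m).Normal := hVn m
  -- the fixed field `K_m` of `V_m`, a number field
  obtain ⟨Km, hKmfin, hKm⟩ := exists_galFixing_eq_of_isOpen (V m) (hVo m)
  haveI : FiniteDimensional K Km := hKmfin
  haveI : CharZero Km := charZero_of_injective_algebraMap (algebraMap K Km).injective
  haveI : NumberField Km :=
    { to_charZero := inferInstance
      to_finiteDimensional := Module.Finite.trans K Km }
  haveI : Algebra.IsAlgebraic K Km := Algebra.IsAlgebraic.of_finite K Km
  -- `res(Γ_{K_m}) = V_m`
  obtain ⟨τ, hτ⟩ := exists_range_absGaloisRestrict_eq_map_conj K Km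
  have hVconj : (V m).map (MulAut.conj τ).toMonoidHom = V m := by
    ext x
    constructor
    · rintro ⟨y, hy, rfl⟩
      exact (hVn m).conj_mem y hy τ
    · intro hx
      refine ⟨τ⁻¹ * x * τ, ?_, ?_⟩
      · have := (hVn m).conj_mem x hx τ⁻¹
        rwa [inv_inv] at this
      · change τ * (τ⁻¹ * x * τ) * τ⁻¹ = x
        group
  have hrange : ((absGaloisRestrict K Km : absoluteGaloisGroup Km →ₜ* absoluteGaloisGroup K) :
      absoluteGaloisGroup Km →* absoluteGaloisGroup K).range = V m := by
    rw [hτ, hKm, hVconj]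
  have hVres : ∀ σ : absoluteGaloisGroup Km, absGaloisRestrict K Km σ ∈ V m := fun σ => by
    rw [← hrange]; exact ⟨σ, rfl⟩
  -- the base change of `e` to `Γ_{K_m}` is locally trivial everywhere
  obtain ⟨he'_lc, he'_coc⟩ := twoCocycle_baseChange K Km e he_lc he_coc
  have hfin' := fun w' : HeightOneSpectrum (𝓞 Km) =>
    exists_cob_adicCompletion_baseChange_of_subgroup e he_lc he_coc (V m) hVres w' (hmP (w'.under (𝓞 K)))
  have hinf' : ∀ w : InfinitePlace Km,
      ∃ b : absoluteGaloisGroup w.Completion → (AlgebraicClosure w.Completion)ˣ,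
        IsLocallyConstant b ∧ ∀ x y,
          Units.map (absClosureEmbedding Km w.Completion : AlgebraicClosure Km →* AlgebraicClosure w.Completion)
            (Units.map (absClosureEmbedding K Km : AlgebraicClosure K →* AlgebraicClosure Km)
              (e (absGaloisRestrict K Km (absGaloisRestrict Km w.Completion x))
                (absGaloisRestrict K Km (absGaloisRestrict Km w.Completion y)))) =
          b x * x • b y / b (x * y) := fun w' =>
    exists_cob_infinitePlace_baseChange e he_lc he_coc w' (hinfK (w'.comap (algebraMap K Km)))
  -- ABHN over `K_m`: `e' = ∂b'`
  obtain ⟨b', hb'_lc, hb'⟩ := twoCocycle_cob_of_locallyTrivial (K := Km)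
    (fun x y => Units.map (absClosureEmbedding K Km : AlgebraicClosure K →* AlgebraicClosure Km)
      (e (absGaloisRestrict K Km x) (absGaloisRestrict K Km y))) he'_lc he'_coc hfin' hinf'
  clear hfin' hinf' he'_lc he'_coc hmP hgood hP
  -- transport the splitting back to `V_m = res(Γ_{K_m})` along `K̄ ≅ K̄_m`
  set i : absoluteGaloisGroup Km →ₜ* absoluteGaloisGroup K := absGaloisRestrict K Km with hi_def
  set ιm : AlgebraicClosure K →ₐ[K] AlgebraicClosure Km := absClosureEmbedding K Km with hιm_def
  haveI : Algebra.IsAlgebraic K (AlgebraicClosure Km) := Algebra.IsAlgebraic.trans K Km (AlgebraicClosure Km)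
  have hιbij : Function.Bijective ιm :=
    (Algebra.IsAlgebraic.algHom_bijective₂ ιm
      (IsAlgClosed.lift (R := K) (M := AlgebraicClosure K) (S := AlgebraicClosure Km))).1
  set ιe : AlgebraicClosure K ≃ₐ[K] AlgebraicClosure Km := AlgEquiv.ofBijective ιm hιbij with hιe_def
  have hιe : ∀ x, ιe x = ιm x := fun _ => rfl
  have hιsmul : ∀ (x : absoluteGaloisGroup Km) (z : AlgebraicClosure Km),
      ιe.symm (x • z) = (i x) • ιe.symm z := fun x z => by
    apply ιe.injective
    rw [AlgEquiv.apply_symm_apply, hιe, hιm_def, hi_def, absGaloisRestrict_apply_smul, ← hιe ,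
      AlgEquiv.apply_symm_apply]
  have hrinj : Function.Injective i := hi_def ▸ absGaloisRestrict_injective K Km
  have hrange' : ((i : absoluteGaloisGroup Km →ₜ* absoluteGaloisGroup K) :
      absoluteGaloisGroup Km →* absoluteGaloisGroup K).range = V m := by rw [hi_def]; exact hrange
  let ψ₀ : absoluteGaloisGroup Km ≃ (V m) :=
    (Equiv.ofInjective i hrinj).trans (Equiv.setCongr (congrArg (fun H : Subgroup (absoluteGaloisGroup K) =>
      (H : Set (absoluteGaloisGroup K))) hrange'))
  have hψ₀ : Continuous ψ₀ := Continuous.subtype_mk i.continuous _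
  haveI : CompactSpace (V m) := isCompact_iff_compactSpace.mp (Subgroup.isClosed_of_isOpen _ (hVo m)).isCompact
  let ψ : absoluteGaloisGroup Km ≃ₜ (V m) := hψ₀.homeoOfEquivCompactToT2
  have hψ : ∀ x, ((ψ x : V m) : absoluteGaloisGroup K) = i x := fun x => rfl
  have hψsymm : ∀ s : V m, i (ψ.symm s) = s := fun s => by rw [← hψ, ψ.apply_symm_apply]
  have hψmul : ∀ s t : V m, ψ.symm (s * t) = ψ.symm s * ψ.symm t := fun s t => by
    apply hrinj
    rw [map_mul i (ψ.symm s) (ψ.symm t), hψsymm, hψsymm, hψsymm]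
    rfl
  -- the transported cochain
  let B : V m → (AlgebraicClosure K)ˣ := fun s =>
    Units.map (ιe.symm : AlgebraicClosure Km →* AlgebraicClosure K) (b' (ψ.symm s))
  have hB_lc : IsLocallyConstant B :=
    (hb'_lc.comp_continuous ψ.symm.continuous).comp _
  have hleft : ∀ u : (AlgebraicClosure K)ˣ,
      Units.map (ιe.symm : AlgebraicClosure Km →* AlgebraicClosure K)
        (Units.map (ιm : AlgebraicClosure K →* AlgebraicClosure Km) u) = u := fun u =>
    Units.ext (by
      rw [Units.coe_map, MonoidHom.coe_coe, Units.coe_map, MonoidHom.coe_coe, ← hιe]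
      exact ιe.symm_apply_apply (u : AlgebraicClosure K))
  have hsm : ∀ (x : absoluteGaloisGroup Km) (u : (AlgebraicClosure Km)ˣ),
      Units.map (ιe.symm : AlgebraicClosure Km →* AlgebraicClosure K) (x • u) =
        (i x) • Units.map (ιe.symm : AlgebraicClosure Km →* AlgebraicClosure K) u := fun x u =>
    Units.ext (by
      rw [Units.coe_map, MonoidHom.coe_coe, Units.coe_smul, Units.coe_smul, Units.coe_map, MonoidHom.coe_coe]
      exact hιsmul x u)
  have hBe : ∀ s t : V m, e s t = B s * (s : absoluteGaloisGroup K) • B t / B (s * t) := by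
    intro s t
    have key := hb' (ψ.symm s) (ψ.symm t)
    rw [← hψmul] at key
    have key' := congrArg (Units.map (ιe.symm : AlgebraicClosure Km →* AlgebraicClosure K)) key
    rw [map_div, map_mul, hsm, hψsymm, hψsymm, hleft] at key'
    exact key'
  -- conclusion: `res_{V_m} [F] = 0`
  rw [hKc, resH_twoCocycleClass, twoCocycleClass_eq_zero_iff]
  refine ⟨⟨fun s => UnitsCarrier.ofUnits (B s), ?_⟩, fun s t => ?_⟩
  · exact (hB_lc.comp UnitsCarrier.ofUnits).continuous
  · rw [contTwoCocycles.pullback_apply]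
    change F.1 ((s : absoluteGaloisGroup K), (t : absoluteGaloisGroup K)) =
      units K (s : absoluteGaloisGroup K) (UnitsCarrier.ofUnits (B t)) - UnitsCarrier.ofUnits (B (s * t)) +
        UnitsCarrier.ofUnits (B s)
    rw [hF, units_apply_ofUnits, ← ofUnits_div, ← ofUnits_mul, hBe s t]
    congr 1
    rw [mul_comm (B s) _, mul_div_right_comm]

end Main

end Literature.NumberTheory.GaloisCohomology

end
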